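import Mathlib
import Literature.AlgebraicGeometry.Resolution.PointBlowupPolygonLaws
import Literature.AlgebraicGeometry.Resolution.SolvableVertexTransport
import Literature.AlgebraicGeometry.Resolution.FacePreparation
import HarnessLib

/-!
# The vertex at the origin of the `u₁`-chart: `v′`-preparedness from `w⁻`-preparedness

Topic: `Literature/AlgebraicGeometry/Resolution`. Cossart–Jannsen–Saito, LNM 2270,
Lemma 12.1 (4): "If `(f, y, u)` is prepared at `w⁻(f, y, u)`, then `(f′, y′, u′)` is
`v′`-prepared" (the origin `(1:0)` of the `u₁`-chart; `v′ = (δ − 1, γ⁻)`; Cossart–Piltant 2008,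
Lemma 4.5 (2) at `x′₀ = (0, 0)`: "`β(x′) ≤ γ⁻(x) < β(x)` if the vertex `w⁻` is prepared"). PROVED
(no facts), in the expansion-free setting:

* `forall_pts_tilt`, `eq_wMinus_of_tilt` — every tilted `δ`-line `N x₁ + (N+1) x₂ = N δs + γ⁻s`
  with `N ≥ γ⁻s` supports the polygon, and meets it only at `w⁻` when `N ≥ γ⁻s + 1`;
* `vPrepared_colon_of_wMinusPrepared` — **`w⁻`-prepared ⇒ `v′`-prepared** (residue map
  surjective), by `isSolvableAt_of_chart` and the independence of the supporting line.

## Sources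

* V. Cossart, U. Jannsen, S. Saito, LNM 2270 (2020), Lemma 12.1 (3)–(4), Lemma 8.3.
  [CossartJannsenSaito2020]
* V. Cossart, O. Piltant, J. Algebra 320 (2008), Lemma 4.5 (2), the point `x′₀`. [CossartPiltant2008]
-/

noncomputable section

open IsLocalRing MvPolynomial

namespace Literature.AlgebraicGeometry.Resolution

universe u

/-! ## Tilted `δ`-lines -/

section Tilt

variable {R : Type u} [CommRing R] {c : Fin 3 → R} {J : Ideal R} {μ : ℕ}

/-- **Tilted `δ`-lines support the polygon**: `N δs + γ⁻s ≤ N x₁ + (N+1) x₂` on `pts` for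
`N ≥ γ⁻s`. [cite: CossartJannsenSaito2020, Lemma 12.1 (4)] -/
theorem forall_pts_tilt {N : ℕ} (hN : gammaMinusS c J μ ≤ N) :
    ∀ e ∈ pts c J μ, N * deltaS c J μ + gammaMinusS c J μ ≤ N * spt₁ μ e + (N + 1) * spt₂ μ e := by
  intro e he
  have hsplit : N * spt₁ μ e + (N + 1) * spt₂ μ e = N * (spt₁ μ e + spt₂ μ e) + spt₂ μ e := by ring
  rw [hsplit]
  have hδ := deltaS_le he
  rcases hδ.eq_or_lt with heq | hlt
  · have hγ := gammaMinusS_le he heq.symm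
    rw [← heq]; omega
  · have h1 : deltaS c J μ + 1 ≤ spt₁ μ e + spt₂ μ e := hlt
    have := Nat.mul_le_mul_left N h1
    rw [Nat.mul_add, mul_one] at this
    omega

/-- On a tilted `δ`-line with `N ≥ γ⁻s + 1`, the only point of the polygon is `w⁻`.
[cite: CossartJannsenSaito2020, Lemma 12.1 (4)] -/
theorem eq_wMinus_of_tilt {N : ℕ} (hN : gammaMinusS c J μ + 1 ≤ N) {e : Fin 3 →₀ ℕ}
    (he : e ∈ pts c J μ)
    (h : N * spt₁ μ e + (N + 1) * spt₂ μ e = N * deltaS c J μ + gammaMinusS c J μ) :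
    spt₁ μ e + spt₂ μ e = deltaS c J μ ∧ spt₂ μ e = gammaMinusS c J μ := by
  have hsplit : N * spt₁ μ e + (N + 1) * spt₂ μ e = N * (spt₁ μ e + spt₂ μ e) + spt₂ μ e := by ring
  rw [hsplit] at h
  have hδ := deltaS_le he
  rcases hδ.eq_or_lt with heq | hlt
  · have hγ := gammaMinusS_le he heq.symm
    rw [← heq] at h
    exact ⟨heq.symm, by omega⟩
  · exfalso
    have h1 : deltaS c J μ + 1 ≤ spt₁ μ e + spt₂ μ e := hlt
    have := Nat.mul_le_mul_left N h1
    rw [Nat.mul_add, mul_one] at this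
    omega

end Tilt

/-! ## The origin of the `u₁`-chart -/

section ChartOne

variable {R R' : Type u} [CommRing R] [CommRing R'] (φ : R →+* R') {c : Fin 3 → R}
  {c' : Fin 3 → R'} (h₁ : c' 1 = φ (c 1)) (h₀ : φ (c 0) = φ (c 1) * c' 0)
  (h₂ : φ (c 2) = φ (c 1) * c' 2) {J : Ideal R} {μ : ℕ}
  [IsRegularLocalRing R] [IsRegularLocalRing R']
  (hgen : Ideal.span {c 0, c 1, c 2} = maximalIdeal R) (hdim : ringKrullDim R = 3)
  (hgen' : Ideal.span {c' 0, c' 1, c' 2} = maximalIdeal R') (hdim' : ringKrullDim R' = 3)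

local notation "J'" => Submodule.colon (Ideal.map φ J) ({φ (c 1) ^ μ} : Set R')

include h₁ h₀ h₂ hgen hdim hgen' hdim' in
/-- **`w⁻`-prepared ⇒ `v′`-prepared** (CJS Lemma 12.1 (4)): at the origin of the `u₁`-chart,
with `J ⊆ 𝔪^μ`, `δ > 1` and surjective residue map, if `(y, u)` is prepared at `w⁻` then the
weak transform is `v′`-prepared for `(y′, u₁, u₂′)`. [cite: CossartJannsenSaito2020, Lemma 12.1 (4)]
[cite: CossartPiltant2008, Lemma 4.5 (2)] -/
theorem vPrepared_colon_of_wMinusPrepared [IsLocalHom φ] (hψ : Function.Surjective (ResidueField.map φ))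
    (hJμ : J ≤ maximalIdeal R ^ μ) (hne : (pts c J μ).Nonempty) (hδ : μ.factorial < deltaS c J μ)
    (hprep : WMinusPrepared c J μ) : VPrepared c' J' μ := by
  have hne' := pts_colon_nonempty φ h₁ h₀ h₂ hgen hdim hgen' hdim' hJμ hne hδ
  have hα' := alphaS_colon_add φ h₁ h₀ h₂ hgen hdim hgen' hdim' hJμ hne hδ
  have hβ' := betaS_colon_eq φ h₁ h₀ h₂ hgen hdim hgen' hdim' hJμ hne hδ
  have hγδ : gammaMinusS c J μ ≤ deltaS c J μ := by
    obtain ⟨e, -, hsum, h2⟩ := exists_pts_wMinus hne; omega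
  intro v₁ v₂ lam' hv1 hv2 hsol
  -- `w⁻ = L (v₁ + 1 − v₂, v₂)`
  have hv12 : v₂ ≤ v₁ + 1 := by
    by_contra hlt
    push Not at hlt
    have : μ.factorial * (v₁ + 1) < μ.factorial * v₂ :=
      Nat.mul_lt_mul_of_pos_left hlt (Nat.factorial_pos μ)
    rw [Nat.mul_add, mul_one, ← hv1, ← hv2, hα', hβ'] at this
    omega
  set vR₁ := v₁ + 1 - v₂ with hvR₁
  have hw2 : gammaMinusS c J μ = μ.factorial * v₂ := by rw [← hβ', hv2]
  have hw1 : deltaS c J μ = μ.factorial * vR₁ + gammaMinusS c J μ := by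
    have : μ.factorial * vR₁ + μ.factorial * v₂ = μ.factorial * (v₁ + 1) := by
      rw [← Nat.mul_add]; congr 1; omega
    rw [Nat.mul_add, mul_one, ← hv1, hα'] at this
    omega
  -- a steep line at `x′`: `N⋆ x₁ + x₂` with `N⋆ = βs′ + γ⁻s + 1`
  set Ns := betaS c' J' μ + gammaMinusS c J μ + 1 with hNs
  have hNs1 : betaS c' J' μ + 1 ≤ Ns := by omega
  have hab : 0 < alphaS c' J' μ + betaS c' J' μ := by omega
  have hposS : 0 < Ns * alphaS c' J' μ + betaS c' J' μ := by
    have : alphaS c' J' μ ≤ Ns * alphaS c' J' μ := Nat.le_mul_of_pos_left _ (by omega)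
    omega
  have hposV : 0 < vLevel c' J' μ := by
    rw [vLevel, steepN]
    have : alphaS c' J' μ ≤ (betaS c' J' μ + 1) * alphaS c' J' μ := Nat.le_mul_of_pos_left _ (by omega)
    omega
  set W' : Fin 3 → ℕ := levelWeight μ (Ns * alphaS c' J' μ + betaS c' J' μ) Ns 1 with hW'
  have hW'pos : ∀ i, 0 < W' i := levelWeight_pos hposS (by omega) Nat.one_pos
  have hsolS : IsSolvableAt c' J' W' ((Ns * alphaS c' J' μ + betaS c' J' μ) * μ) μ (vexp v₁ v₂) lam' :=
    (isSolvableAt_iff_of_same_vertex c' hgen' hdim' (J := J') (μ := μ)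
      (w₀ := vLevel c' J' μ) (p₁ := steepN c' J' μ) (p₂ := 1)
      (q₀ := Ns * alphaS c' J' μ + betaS c' J' μ) (q₁ := Ns) (q₂ := 1) (v₁ := v₁) (v₂ := v₂)
      hposV (by rw [steepN]; omega) Nat.one_pos hposS (by omega) Nat.one_pos
      (by rw [vLevel, ← hv1, ← hv2]; ring) (by rw [← hv1, ← hv2]; ring)
      forall_pts_vWeight (forall_pts_steep hNs1)
      (fun e he h => by
        obtain ⟨ha, hb⟩ := eq_v_of_vLine he h
        exact ⟨by rw [ha, hv1], by rw [hb, hv2]⟩)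
      (fun e he h => by
        obtain ⟨ha, hb⟩ := eq_v_of_steep hNs1 he h
        exact ⟨by rw [ha, hv1], by rw [hb, hv2]⟩) lam').mp hsol
  -- a lift of `λ′`
  obtain ⟨lamR, hlamR⟩ : ∃ a : R, residue R' (φ a) = lam' := by
    obtain ⟨b, hb⟩ := hψ lam'
    obtain ⟨a, rfl⟩ := residue_surjective (R := R) b
    exact ⟨a, by rw [← hb, ResidueField.map_residue]⟩
  -- pull back through the chart
  have hv : 1 ≤ vR₁ + v₂ := by omega
  have hvW : Finsupp.weight (pullbackWeight W') (vexp vR₁ v₂) = pullbackWeight W' 0 := by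
    rw [weight_vexp]
    simp only [hW', pullbackWeight, levelWeight_zero, levelWeight_one, levelWeight_two,
      Matrix.cons_val_zero, Matrix.cons_val_one, Matrix.cons_val_two, Matrix.tail_cons,
      Matrix.head_cons]
    have : μ.factorial * vR₁ + μ.factorial * v₂ = μ.factorial * v₁ + μ.factorial := by
      rw [← Nat.mul_add, ← Nat.mul_succ]; congr 1; omega
    nlinarith [this]
  have hvexp : vexp (vR₁ + v₂ - 1) v₂ = vexp v₁ v₂ := by
    have : vR₁ + v₂ - 1 = v₁ := by omega
    rw [this]
  have hlev : μ * W' 0 = (Ns * alphaS c' J' μ + betaS c' J' μ) * μ := by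
    rw [hW', levelWeight_zero, mul_comm]
  have hsolS' : IsSolvableAt c' J' W' (μ * W' 0) μ (vexp (vR₁ + v₂ - 1) v₂) (residue R' (φ lamR)) := by
    rw [hvexp, hlev, hlamR]; exact hsolS
  have hsolR := isSolvableAt_of_chart φ h₁ h₀ h₂ W' hgen hdim hgen' hdim' hW'pos hψ hJμ hv hvW hsolS'
  -- the pulled-back weight is the tilted line `Ns x₁ + (Ns+1) x₂ = Ns δs + γ⁻s`
  have hpb : pullbackWeight W' = levelWeight μ (Ns * deltaS c J μ + gammaMinusS c J μ) Ns (Ns + 1) := by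
    funext i
    fin_cases i
    · change W' 0 + W' 1 = levelWeight μ (Ns * deltaS c J μ + gammaMinusS c J μ) Ns (Ns + 1) 0
      rw [hW', levelWeight_zero, levelWeight_one, levelWeight_zero, ← hα', ← hβ']; ring
    · change W' 1 = levelWeight μ (Ns * deltaS c J μ + gammaMinusS c J μ) Ns (Ns + 1) 1
      rw [hW', levelWeight_one, levelWeight_one]
    · change W' 2 + W' 1 = levelWeight μ (Ns * deltaS c J μ + gammaMinusS c J μ) Ns (Ns + 1) 2
      rw [hW', levelWeight_one, levelWeight_two, levelWeight_two]; ring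
  have hlevR : μ * pullbackWeight W' 0 = (Ns * deltaS c J μ + gammaMinusS c J μ) * μ := by
    rw [hpb, levelWeight_zero, mul_comm]
  rw [hpb] at hsolR
  rw [show μ * levelWeight μ (Ns * deltaS c J μ + gammaMinusS c J μ) Ns (Ns + 1) 0 =
      (Ns * deltaS c J μ + gammaMinusS c J μ) * μ from by rw [levelWeight_zero, mul_comm]] at hsolR
  -- same vertex `w⁻` at `x`: convert to the canonical tilted line and contradict `w⁻`-preparedness
  have hNγ : gammaMinusS c J μ + 1 ≤ Ns := by omega
  have hposT : 0 < Ns * deltaS c J μ + gammaMinusS c J μ := by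
    have : 0 < deltaS c J μ := by omega
    have : deltaS c J μ ≤ Ns * deltaS c J μ := Nat.le_mul_of_pos_left _ (by omega)
    omega
  have hposC : 0 < wMinusLevel c J μ := by
    rw [wMinusLevel, tiltN]
    have : deltaS c J μ ≤ (gammaMinusS c J μ + 1) * deltaS c J μ := Nat.le_mul_of_pos_left _ (by omega)
    omega
  refine hprep vR₁ v₂ (residue R lamR) hw1 hw2 ?_
  refine (isSolvableAt_iff_of_same_vertex c hgen hdim (J := J) (μ := μ)
    (w₀ := wMinusLevel c J μ) (p₁ := tiltN c J μ) (p₂ := tiltN c J μ + 1)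
    (q₀ := Ns * deltaS c J μ + gammaMinusS c J μ) (q₁ := Ns) (q₂ := Ns + 1) (v₁ := vR₁) (v₂ := v₂)
    hposC (by rw [tiltN]; omega) (by omega) hposT (by omega) (by omega)
    (by rw [wMinusLevel, hw1, hw2]; ring) (by rw [hw1, hw2]; ring)
    forall_pts_wMinusWeight (forall_pts_tilt (by omega))
    (fun e he h => by
      obtain ⟨hs, hb⟩ := eq_wMinus_of_wMinusLine he h
      exact ⟨by omega, by omega⟩)
    (fun e he h => by
      obtain ⟨hs, hb⟩ := eq_wMinus_of_tilt hNγ he h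
      exact ⟨by omega, by omega⟩) (residue R lamR)).mpr hsolR

end ChartOne

end Literature.AlgebraicGeometry.Resolution
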